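import Summits.BirchSwinnertonDyer.BirchSwinnertonDyer.Theses.TwistFamilyManinDescent
import Literature.NumberTheory.EllipticCurves.ModularCurveManinConstantProofs

/-!
# E-free Eisenstein law — the cell datum `(dim V, rank Ξ̄)` behind NV″ (crux stmt-BirchSwinnertonDyer-25138, seat 1, g14)

Companion of `OrdinaryCMTorsorEisensteinSketch.lean` (Theorem ★: on an ordinary Case-A row NV″ ⟺ `p ∤ c(E)`) and of the
note `Ideas/ordinary-cm-torsor-efree.md`, census `CENSUS-efree-g14.md`.

E-FREE OBJECTS (no elliptic curve): for a level `N = p² M` (`p ≥ 5`, `p ∤ M`), a digit `b ∈ [1, p−2]`, an `𝔽_p`-valued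
character `χ₀` of `(ℤ/M)^×` and a `U_ℓ`-eigenvalue pattern `σ = (σ_ℓ)_{ℓ ∣ M}`, the CELL
`V(b,χ₀,σ) ⊂ C(N)[p]` (full cuspidal divisor class group, `p`-torsion) is cut out by `σ_a = ω^b(a)`, `σ_m = χ₀(m)`,
`T_ℓ = ℓ^b χ₀(ℓ) + ℓ^{1−b} χ₀(ℓ)⁻¹ (ℓ ∤ N)`, `U_p = 0`, `U_ℓ = σ_ℓ`; and `Ξ̄ : V → 𝓞/p`, `[D] ↦ p·a₁(E_D) mod p`
(`E_D` = weight-2 Eisenstein series with residue divisor `D`, Stevens' `δ⁻¹`).  Galois-equivariance of `Ξ̄`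
(Stevens Thm 1.3.1) and `dim_{𝔽_p} (𝓞/p)^{(ω^b,χ₀)} ≤ 1` give `rank Ξ̄|_V ≤ 1`; the LAW (T12E) is `rank Ξ̄|_V = dim V`.

CHAIN (kernel-checked below): (T12E on the curve's cell) ∧ (ι(C) is a nonzero vector of that cell — K1 cuspidality +
I9 Case A + the Eisenstein congruences of `A_f`) ∧ ★ ⟹ `p ∤ c(E)`; assembled over rows it gives `NVppLaw`, hence the
crux by `crux_of_nvppLaw`.  Everything curve-specific sits in the two posited interfaces; their CONSTRUCTION is the
line's work (stubs S★, I9, K1), not a field smuggled in here.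

BSD is not proved by this; Manin `c = 1` is not proved by this.
-/

namespace Summit.BirchSwinnertonDyer.BirchSwinnertonDyer.Cruxes.EisensteinAdditiveManinResidual.EfreeLaw

open Literature.NumberTheory.EllipticCurves.ModularForms

/-! ## ★-interface (verbatim copy of the g13 decls of `OrdinaryCMTorsorEisensteinSketch.lean`, namespace
`…OrdinaryCMTorsor`; copied because Cruxes modules are not importable on the farm) -/

section Star

variable {N : ℕ} [NeZero N] {W : WeierstrassCurve ℚ} [W.IsElliptic]

/-- POSITED INTERFACE (construction = stub S★): the cuspidal Eisenstein torsor datum of an ordinary Case-A row;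
`star` = Theorem ★ `v_π(p a₁(E_{D_S})) = b + (p−1)·v_p(c)`. -/
structure EisensteinTorsorDatum (D : ModularParametrizationData W N) (p : ℕ) where
  b : ℕ
  one_le_b : 1 ≤ b
  b_add_two_le : b + 2 ≤ p
  vpa1 : ℕ∞
  star : vpa1 = (b : ℕ∞) + ((p - 1 : ℕ) : ℕ∞) * emultiplicity (p : ℤ) D.maninConstant

namespace EisensteinTorsorDatum

variable {D : ModularParametrizationData W N} {p : ℕ}

/-- NV″: `a₁(E_{D_S}) ∉ ℤ_p[ζ_p]`, i.e. `v_π(p a₁) < p − 1`. -/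
def NVpp (T : EisensteinTorsorDatum D p) : Prop := T.vpa1 < ((p - 1 : ℕ) : ℕ∞)

/-- ★ ⇒ (NV″ ⟺ `p ∤ c`). -/
theorem nvpp_iff_not_dvd (T : EisensteinTorsorDatum D p) :
    T.NVpp ↔ ¬ (p : ℤ) ∣ D.maninConstant := by
  unfold NVpp
  rw [T.star]
  constructor
  · intro h hdvd
    have hm : emultiplicity (p : ℤ) D.maninConstant ≠ 0 := by
      rw [Ne, emultiplicity_eq_zero]; exact fun h' => h' hdvd
    have h1 : (1 : ℕ∞) ≤ emultiplicity (p : ℤ) D.maninConstant := Order.one_le_iff_ne_zero.mpr hm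
    have h2 : ((p - 1 : ℕ) : ℕ∞) ≤ ((p - 1 : ℕ) : ℕ∞) * emultiplicity (p : ℤ) D.maninConstant := by
      calc ((p - 1 : ℕ) : ℕ∞) = ((p - 1 : ℕ) : ℕ∞) * 1 := (mul_one _).symm
        _ ≤ ((p - 1 : ℕ) : ℕ∞) * emultiplicity (p : ℤ) D.maninConstant := mul_le_mul_left' h1 _
    have h3 : ((p - 1 : ℕ) : ℕ∞) ≤ (T.b : ℕ∞) + ((p - 1 : ℕ) : ℕ∞) * emultiplicity (p : ℤ) D.maninConstant :=
      le_add_left h2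
    exact absurd h (not_lt.mpr h3)
  · intro hndvd
    have hm : emultiplicity (p : ℤ) D.maninConstant = 0 := emultiplicity_eq_zero.mpr hndvd
    rw [hm, mul_zero, add_zero]
    have : T.b < p - 1 := by have := T.b_add_two_le; omega
    exact_mod_cast this

end EisensteinTorsorDatum

/-- the NV″-law of g13 (a ★-datum with NV″ exists on the row, or `p ∤ c` is known otherwise). -/
def NVppLaw : Prop :=
  ∀ (W : WeierstrassCurve ℚ) [W.IsElliptic] [W.IsGloballyMinimal] {N : ℕ} [NeZero N]
    (D : ModularParametrizationData W N) (p : ℕ) (hp : p.Prime),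
    (p = 5 ∨ p = 7 ∨ p = 13 ∨ (p = 163 ∧ 2 ^ 6 ∣ N)) → p ^ 2 ∣ N → ¬ W.HasIrreducibleModPGaloisRep p →
    ¬ ((W.quadraticTwist (((-1 : ℤ) ^ (p / 2) * p : ℤ) : ℚ)).HasGoodReductionAt
          ((Rat.HeightOneSpectrum.primesEquiv (R := ℤ)).symm ⟨p, hp⟩) ∨
        (W.quadraticTwist (((-1 : ℤ) ^ (p / 2) * p : ℤ) : ℚ)).HasMultiplicativeReductionAt
          ((Rat.HeightOneSpectrum.primesEquiv (R := ℤ)).symm ⟨p, hp⟩)) →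
    (∀ z ∈ D.L.lattice, ∃ w ∈ periodLattice D.f, z = D.c * w) →
    (∃ T : EisensteinTorsorDatum D p, T.NVpp) ∨ ¬ (p : ℤ) ∣ D.maninConstant

/-- `NVppLaw → EisensteinAdditiveManinResidual` (stmt-25138), as in g13. -/
theorem crux_of_nvppLaw (h : NVppLaw) :
    Theses.TwistFamilyManinDescent.EisensteinAdditiveManinResidual := by
  intro _ _ _ _ W _ _ N _ D p hp hrow hN hred htw hopt
  rcases h W D p hp hrow hN hred htw hopt with ⟨T, hT⟩ | hc
  · exact T.nvpp_iff_not_dvd.mp hT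
  · exact hc

end Star

/-! ## The E-free cell datum and the chain -/

/-- E-FREE CELL DATUM of a cell `V(b,χ₀,σ) ⊂ C(p²M)[p]`: its dimension and the rank of `Ξ̄` on it.  The two
inequalities are theorems of the construction (rank ≤ dim trivially; rank ≤ 1 from Galois equivariance and the
one-dimensionality of the `(ω^b,χ₀)`-isotypic part of `ℤ[ζ]/p`). -/
structure EfreeCellDatum where
  /-- `dim_{𝔽_p} V(b,χ₀,σ)` -/
  dimV : ℕ
  /-- `rank_{𝔽_p} Ξ̄|_V` -/
  rankXi : ℕ
  rank_le_dim : rankXi ≤ dimV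
  rank_le_one : rankXi ≤ 1

namespace EfreeCellDatum

/-- (T12E) the E-free law on one cell: `Ξ̄|_V` is injective. -/
def Law (V : EfreeCellDatum) : Prop := V.rankXi = V.dimV

/-- (T1E) multiplicity one is a consequence of the law. -/
theorem dimV_le_one_of_law (V : EfreeCellDatum) (h : V.Law) : V.dimV ≤ 1 := by
  unfold Law at h; have := V.rank_le_one; omega

/-- the law splits as (T1E) `dim V ≤ 1` ∧ (T2E) `V ≠ 0 → Ξ̄|_V ≠ 0`. -/
theorem law_iff (V : EfreeCellDatum) : V.Law ↔ (V.dimV ≤ 1 ∧ (1 ≤ V.dimV → 1 ≤ V.rankXi)) := by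
  unfold Law; have := V.rank_le_one; have := V.rank_le_dim; omega

end EfreeCellDatum

variable {N : ℕ} [NeZero N] {W : WeierstrassCurve ℚ} [W.IsElliptic]

/-- POSITED INTERFACE (construction = stubs K1 + I9 + the Eisenstein congruences of `A_f^∨[𝔪]`): the cuspidal line
`ι(C) = ⟨[D_S]⟩` of the row is a NONZERO vector of the E-free cell `V`, and `Ξ̄([D_S]) ≠ 0` is literally NV″
(`Ξ̄([D_S]) = p·a₁(E_{D_S}) mod p`).  Hence injectivity of `Ξ̄|_V` forces NV″. -/
structure CurveInCell {D : ModularParametrizationData W N} {p : ℕ}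
    (T : EisensteinTorsorDatum D p) (V : EfreeCellDatum) : Prop where
  /-- `ι(C) ≠ 0` lies in `V` -/
  one_le_dimV : 1 ≤ V.dimV
  /-- `Ξ̄|_V` injective ⟹ `Ξ̄(ι(C)) ≠ 0`, i.e. NV″ -/
  nvpp_of_law : V.Law → T.NVpp

/-- **cell-level link** (kernel-checked): law on the curve's cell + ★ ⟹ `p ∤ c(E)`. -/
theorem not_dvd_maninConstant_of_cellLaw {D : ModularParametrizationData W N} {p : ℕ}
    (T : EisensteinTorsorDatum D p) (V : EfreeCellDatum) (hC : CurveInCell T V) (hV : V.Law) :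
    ¬ (p : ℤ) ∣ D.maninConstant :=
  T.nvpp_iff_not_dvd.mp (hC.nvpp_of_law hV)

/-- conversely a failure of NV″ on a row whose cell obeys the law contradicts the membership interface (so on such a
row K1 or I9 must fail) — the E-free census is a genuine test of the line. -/
theorem not_curveInCell_of_not_nvpp {D : ModularParametrizationData W N} {p : ℕ}
    (T : EisensteinTorsorDatum D p) (V : EfreeCellDatum) (hV : V.Law) (h : ¬ T.NVpp) : ¬ CurveInCell T V :=
  fun hC => h (hC.nvpp_of_law hV)

/-- E-FREE CENSUS INTERFACE: an assignment of a cell datum to every index `(p, N, b, χ₀-index, σ-index)`. -/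
structure EfreeCensus where
  cell : ℕ → ℕ → ℕ → ℕ → ℕ → EfreeCellDatum

/-- (T12E) as a global E-free statement: the law on every cell. -/
def EfreeLaw (I : EfreeCensus) : Prop := ∀ p N b i j, (I.cell p N b i j).Law

/-- ROW INTERFACE for the crux range: on every crux row either the ordinary Case-A package (★-datum + membership of
`ι(C)` in an E-free cell) exists, or `p ∤ c` is known by another lever (supersingular corner T17/K15a, Case B via I9, …). -/
def RowPackage (I : EfreeCensus) : Prop :=
  ∀ (W : WeierstrassCurve ℚ) [W.IsElliptic] [W.IsGloballyMinimal] {N : ℕ} [NeZero N]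
    (D : ModularParametrizationData W N) (p : ℕ) (hp : p.Prime),
    (p = 5 ∨ p = 7 ∨ p = 13 ∨ (p = 163 ∧ 2 ^ 6 ∣ N)) → p ^ 2 ∣ N → ¬ W.HasIrreducibleModPGaloisRep p →
    ¬ ((W.quadraticTwist (((-1 : ℤ) ^ (p / 2) * p : ℤ) : ℚ)).HasGoodReductionAt
          ((Rat.HeightOneSpectrum.primesEquiv (R := ℤ)).symm ⟨p, hp⟩) ∨
        (W.quadraticTwist (((-1 : ℤ) ^ (p / 2) * p : ℤ) : ℚ)).HasMultiplicativeReductionAt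
          ((Rat.HeightOneSpectrum.primesEquiv (R := ℤ)).symm ⟨p, hp⟩)) →
    (∀ z ∈ D.L.lattice, ∃ w ∈ periodLattice D.f, z = D.c * w) →
    (∃ (T : EisensteinTorsorDatum D p) (b i j : ℕ), CurveInCell T (I.cell p N b i j)) ∨ ¬ (p : ℤ) ∣ D.maninConstant

/-- **assembled chain** (kernel-checked): E-free law + row package ⟹ `NVppLaw`, hence the crux. -/
theorem nvppLaw_of_efreeLaw (I : EfreeCensus) (hlaw : EfreeLaw I) (hrows : RowPackage I) : NVppLaw := by
  intro W _ _ N _ D p hp hrow hN hred htw hopt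
  rcases hrows W D p hp hrow hN hred htw hopt with ⟨T, b, i, j, hC⟩ | hc
  · exact Or.inl ⟨T, hC.nvpp_of_law (hlaw p N b i j)⟩
  · exact Or.inr hc

theorem crux_of_efreeLaw (I : EfreeCensus) (hlaw : EfreeLaw I) (hrows : RowPackage I) :
    Theses.TwistFamilyManinDescent.EisensteinAdditiveManinResidual :=
  crux_of_nvppLaw (nvppLaw_of_efreeLaw I hlaw hrows)

/-! ## E-free sign rule at a Steinberg prime (kernel-checked table)
For `ℓ ∥ N` a curve on the row has `a_ℓ(E) = s ∈ {±1}` and `ρ̄|_{G_ℓ} ∼ (ψω, ψ)` with `ψ(Frob_ℓ) = s`, so the unordered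
pair `{ℓ^b χ₀(ℓ), ℓ^{1−b} χ₀(ℓ)⁻¹}` must equal `{ℓ s, s}` mod `p`.  The E-free engine finds exactly these `σ_ℓ` among
`{0, ±1}` carrying nonzero cells at the census levels (e.g. `N = 150`: `b = 1 ↦ (σ₂,σ₃) = (1,1)`, `b = 3 ↦ (−1,−1)`). -/

/-- Steinberg-admissible signs `s ∈ {1, −1}` (encoded `1`, `p−1`) for `(p, ℓ, b)` with trivial `χ₀`. -/
def admissibleSigns (p ℓ b : ℕ) : List ℕ :=
  [1, p - 1].filter fun s =>
    let x := ℓ ^ b % p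
    let y := (ℓ ^ (p - 1 - b + 1)) % p   -- ℓ^{1-b} = ℓ^{(p-1)-b+1} mod p
    (x = ℓ * s % p ∧ y = s % p) ∨ (y = ℓ * s % p ∧ x = s % p)

example : admissibleSigns 5 2 1 = [1] := by decide
example : admissibleSigns 5 3 1 = [1] := by decide
example : admissibleSigns 5 2 3 = [4] := by decide   -- σ₂ = −1 at b = 3 (150b1: a₂ = −1)
example : admissibleSigns 5 3 3 = [4] := by decide   -- σ₃ = −1 at b = 3 (150b1: a₃ = −1)
example : admissibleSigns 5 7 1 = [1] := by decide   -- 175a1: a₇ = +1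
example : admissibleSigns 5 7 3 = [4] := by decide   -- 175c1: a₇ = −1
example : admissibleSigns 7 2 1 = [1] := by decide   -- 294b1 (b = 1)
example : admissibleSigns 7 3 4 = [6] := by decide   -- 294a1 (b = 4): a₃ = −1 predicted
example : admissibleSigns 5 11 2 = [1] := by decide  -- ℓ ≡ 1 (mod p): only the split sign; rows 275b1, 950a1 (I0*, b = 2)


/-! ## (ADM) refined, E-free admissibility of a σ-cell (g14, second pass)

For a prime `ℓ ∣ M`, `ℓ ≠ p`, write `v = v_ℓ(M)` and `c = v_ℓ(cond χ₀)` and let `x = ℓ^b χ₀(ℓ)`,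
`y = ℓ^{1-b} χ₀(ℓ)⁻¹ (mod p)` (only used when `c = 0`).  A cell value `σ_ℓ ∈ 𝔽_p` is ADMISSIBLE iff
* `c ≥ 1`:  `v = 2c` and `σ_ℓ = 0`   (both constituents of `ρ̄^ss` tamely/wildly ramified with the same
  conductor exponent `c`; `Swan(ρ_E) = Swan(ρ̄^ss) = 2(c-1)`, tame part `= 2` since `V^{I_ℓ} = 0`);
* `c = 0`:  (`v = 2` and `σ_ℓ = 0`)  or  (`v = 1` and `σ_ℓ = s ∈ {±1}` with `{x, y} = {ℓ s, s}`);
  `v ≥ 3` is never admissible (`Swan(ρ_E) = Swan(ρ̄^ss) = 0` forces `v_ℓ(N_E) ≤ 2`).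
This is conductor bookkeeping for a `p`-Eisenstein `ρ_E` (`p ≥ 5`): Carayol–Livné (`N(ρ̄) ∣ N(ρ)`, equal
wild parts), Atkin–Lehner (`ℓ² ∣ N ⇒ a_ℓ = 0`) and the Steinberg local representation at `ℓ ∥ N`.
Hence a curve generator `ι(C)` can only sit in an ADMISSIBLE cell ("CurveInCell ⇒ admissible"), and the
E-free law (T12E) need only be asked on admissible cells — where the census shows 0 failures. -/

/-- admissibility of the value `σ` (a residue in `{0,…,p-1}`) at the prime `ℓ` for digit `b`, level
exponent `v = v_ℓ(M)`, character conductor exponent `c = v_ℓ(cond χ₀)` and `χ₀(ℓ) = u` (a unit residue,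
`u = 1` for trivial `χ₀`; ignored when `c ≥ 1`). -/
def cellAdmissibleAt (p ℓ b v c u σ : ℕ) : Bool :=
  if 1 ≤ c then (v == 2 * c) && (σ == 0)
  else if v == 2 then σ == 0
  else if v == 1 then
    let uinv := (List.range p).find? (fun w => u * w % p == 1) |>.getD 0
    let x := ℓ ^ b * u % p
    let y := ℓ ^ (p - 1 - b + 1) * uinv % p
    (σ == 1 || σ == p - 1) && ((x == ℓ * σ % p && y == σ % p) || (y == ℓ * σ % p && x == σ % p))
  else false

-- the harmless law failures of the census are exactly non-admissible cells:
example : cellAdmissibleAt 5 2 3 3 0 1 0 = false := by decide   -- N = 200 = 5²·8: v₂(M) = 3, never a curve cell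
example : cellAdmissibleAt 7 2 4 3 0 1 0 = false := by decide   -- N = 392 = 7²·8
example : cellAdmissibleAt 5 2 3 4 0 1 0 = false := by decide   -- N = 400, χ₀ trivial: v₂(M) = 4 needs cond-4 χ₀
example : cellAdmissibleAt 5 2 3 4 2 1 0 = true  := by decide   -- N = 400, χ₀ = χ₄ (c = 2): the cell of 400c1
example : cellAdmissibleAt 5 2 3 2 0 1 4 = false := by decide   -- N = 100: σ₂ = −1 at additive ℓ = 2
example : cellAdmissibleAt 5 2 3 2 0 1 0 = true  := by decide   -- N = 100: σ₂ = 0 (law holds there)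
example : cellAdmissibleAt 5 3 3 2 0 1 4 = false := by decide   -- N = 225: σ₃ = −1 = β₃ with 3² ∣ M (Ξ̄ = 0 there)
example : cellAdmissibleAt 5 3 1 2 1 2 0 = true  := by decide   -- N = 450, χ₀ = χ₃ (c = 1, v₃(M) = 2): cell of 450c1
-- multiplicative primes: Steinberg signs (agree with `admissibleSigns`)
example : cellAdmissibleAt 5 2 3 1 0 1 4 = true  := by decide   -- 150b1: a₂ = −1 at b = 3
example : cellAdmissibleAt 5 2 3 1 0 1 1 = false := by decide
example : cellAdmissibleAt 5 2 1 1 0 1 1 = true  := by decide   -- 150a1: a₂ = +1 at b = 1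
example : cellAdmissibleAt 7 3 4 1 0 1 6 = true  := by decide   -- 294a1: a₃ = −1 at b = 4
example : cellAdmissibleAt 5 11 2 1 0 1 1 = true := by decide   -- 275b1, ℓ ≡ 1 (mod p)

end Summit.BirchSwinnertonDyer.BirchSwinnertonDyer.Cruxes.EisensteinAdditiveManinResidual.EfreeLaw
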